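import Literature.NumberTheory.GaloisRepresentations.CohomologicalDimensionTowerProofs
import Literature.NumberTheory.GaloisRepresentations.ProfiniteContinuousSection
import HarnessLib

/-!
# Shapiro's lemma in vanishing form: `H^q(S, A) = 0 ⇒ H^q(G, M_G^S(A)) = 0`

For a closed subgroup `S` of a profinite group `G` and a discrete `S`-module `A`, Serre
(*Cohomologie galoisienne*, I §2.5 Prop. 10; Shatz, *Profinite groups, arithmetic, and geometry*,
II §2 Thm. 8, the Faddeev–Shapiro lemma) proves `H^q(G, M_G^S(A)) = H^q(S, A)` for the induced
module `M_G^S(A) = {a* : G → A | a*(s x) = s a*(x)}` (`CoinducedModule.lean`).  The tree has the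
surjectivity half (`CohomologicalDimensionProofs.lean`: `H^q(S, A)` is a retract of
`H^q(G, M_G^S(A))`, which proves I §3.3 Prop. 14).  This file proves the **other half in vanishing
form**, which is what descent arguments need ("if the cohomology of the subgroup vanishes, so does
that of the induced module"):

* `subsingleton_coindRep_of_subsingleton` — `H^{n+1}(S, A) = 0 ⇒ H^{n+1}(G, M_G^S(A)) = 0`.

The proof is Serre's remark "`B ↦ M_G^H(B)` est un foncteur exact" together with dimension
shifting (Shatz II §2 Prop. 6), instead of the homotopy inverse of the printed proofs:

* `M_G^S` is an **exact functor** on discrete `S`-modules (`isSES_coindMap`; surjectivity uses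
  the continuous `S`-equivariant retraction `r : G → S` of I §1.2 Prop. 1,
  `ProfiniteContinuousSection.lean`: a lift of `a* ∈ M_G^S(A₃)` is
  `x ↦ r(x) · h(a*(r(x)⁻¹ x))` for any set-theoretic section `h`);
* `M_G^S` of the coinduced `S`-module `C(S, A)` is the coinduced `G`-module of the trivial
  module `A`: `M_G^S(C(S, A)) ≅ C(G, A)`, `a* ↦ (x ↦ a*(x⁻¹)(1))` with inverse
  `f ↦ (x ↦ (y ↦ y · f(x⁻¹ y)))` (`coindCoindIso`; this is the transitivity
  `M_G^S ∘ M_S^1 = M_G^1` composed with the untwisting isomorphisms), hence `G`-acyclic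
  (`subsingleton_coindRep_coind`);
* the `G`-invariants of `M_G^S(B)` are the constants with value in `B^S`
  (`coindRep_invariants_iff`), so that in degree one the criterion
  `IsSES.subsingleton_one` applies, the lift of invariants coming from `H¹(S, A) = 0` on the
  `S`-side (`IsSES.exists_invariant_lift`);
* induction on the degree: `H^{n+2}(S, A) = 0 ⇒ H^{n+1}(S, Q) = 0` for `Q = C(S, A)/A`
  (`IsSES.subsingleton_X₃`), the induction hypothesis gives `H^{n+1}(G, M_G^S(Q)) = 0`, and
  `IsSES.subsingleton_X₁` along `0 → M_G^S(A) → M_G^S(C(S, A)) → M_G^S(Q) → 0` concludes.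

## References

* J.-P. Serre, *Cohomologie galoisienne*, 5e éd., LNM 5 (1994) / *Galois Cohomology* (1997),
  I §1.2 Prop. 1, I §2.5 (statements 1)–3), Prop. 10). [SerreGaloisCohomology1997]
* S. S. Shatz, *Profinite groups, arithmetic, and geometry* (1972), Ch. II §2 Prop. 5, Prop. 6,
  Thm. 8 (Faddeev–Shapiro). [Shatz1972]
-/

noncomputable section

open CategoryTheory Topology Set

universe u

namespace Literature.NumberTheory.GaloisRepresentations

open _root_.TopRep _root_.ContRepresentation _root_.ContinuousCohomology

/-! ### `M_G^S` as a functor on discrete `S`-modules -/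

section Functor

variable {G : Type u} [Group G] [TopologicalSpace G] [IsTopologicalGroup G] [CompactSpace G]
variable {S : Subgroup G}
variable {A₁ : Type u} [AddCommGroup A₁] [TopologicalSpace A₁] [DiscreteTopology A₁]
variable {A₂ : Type u} [AddCommGroup A₂] [TopologicalSpace A₂] [DiscreteTopology A₂]
variable {A₃ : Type u} [AddCommGroup A₃] [TopologicalSpace A₃] [DiscreteTopology A₃]
variable {σ₁ : ContinuousRep S ℤ A₁} {σ₂ : ContinuousRep S ℤ A₂} {σ₃ : ContinuousRep S ℤ A₃}

omit [IsTopologicalGroup G] [CompactSpace G] in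
/-- A morphism of discrete `S`-modules commutes with the actions, on elements. [folklore] -/
theorem hom_comm_rep (f : σ₁.toTopRep ⟶ σ₂.toTopRep) (s : S) (a : A₁) :
    f.hom (σ₁ s a) = σ₂ s (f.hom a) :=
  TopRep.hom_comm_apply f s a

/-- `M_G^S(f)` on one element: post-composition `a* ↦ f ∘ a*` (it lands in `M_G^S(A₂)` because
`f` is `S`-equivariant). [cite: SerreGaloisCohomology1997, I §2.5] -/
def coindMapFun (f : σ₁.toTopRep ⟶ σ₂.toTopRep) (F : coindModule σ₁) : coindModule σ₂ :=
  ⟨⟨fun x => f.hom ((F : C(G, A₁)) x), (map_continuous f.hom).comp (F : C(G, A₁)).continuous⟩,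
    fun s x => by
      change f.hom ((F : C(G, A₁)) ((s : G) * x)) = σ₂ s (f.hom ((F : C(G, A₁)) x))
      rw [(mem_coind_iff σ₁ _).1 F.2 s x]
      exact hom_comm_rep f s _⟩

omit [IsTopologicalGroup G] [CompactSpace G] in
/-- Unfolding `coindMapFun`. [folklore] -/
@[simp] theorem coindMapFun_coe_apply (f : σ₁.toTopRep ⟶ σ₂.toTopRep) (F : coindModule σ₁)
    (x : G) : ((coindMapFun f F : coindModule σ₂) : C(G, A₂)) x = f.hom ((F : C(G, A₁)) x) := rfl

/-- **Functoriality of the induced module**: `M_G^S(f) : M_G^S(A₁) → M_G^S(A₂)`, `a* ↦ f ∘ a*`, a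
morphism of the discrete `G`-modules `coindRep` (Serre I §2.5: `B ↦ M_G^H(B)` "est un
foncteur"). [cite: SerreGaloisCohomology1997, I §2.5] -/
def coindMap (f : σ₁.toTopRep ⟶ σ₂.toTopRep) :
    (coindRep σ₁).toTopRep ⟶ (coindRep σ₂).toTopRep :=
  TopRep.ofHom
    { toLinearMap :=
        { toFun := coindMapFun f
          map_add' := fun F F' => Subtype.ext (ContinuousMap.ext fun x => by
            change f.hom ((F : C(G, A₁)) x + (F' : C(G, A₁)) x) = _
            rw [map_add]; rfl)
          map_smul' := fun c F => Subtype.ext (ContinuousMap.ext fun x => by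
            change f.hom (c • (F : C(G, A₁)) x) = _
            rw [map_zsmul]; rfl) }
      cont := by
        haveI := discreteTopology_coind (S := S) σ₁
        exact continuous_of_discreteTopology
      isIntertwining' := fun g => by
        ext F x
        rfl }

/-- `coindMap f` on elements. [folklore] -/
@[simp] theorem coindMap_hom_coe_apply (f : σ₁.toTopRep ⟶ σ₂.toTopRep) (F : coindModule σ₁)
    (x : G) : (((coindMap f).hom F : coindModule σ₂) : C(G, A₂)) x = f.hom ((F : C(G, A₁)) x) :=
  rfl

/-- `M_G^S` preserves composites vanishing: `f ≫ g = 0 ⇒ coindMap f ≫ coindMap g = 0`.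
[folklore] -/
theorem coindMap_comp_eq_zero (f : σ₁.toTopRep ⟶ σ₂.toTopRep) (g : σ₂.toTopRep ⟶ σ₃.toTopRep)
    (hfg : f ≫ g = 0) : coindMap f ≫ coindMap (G := G) g = 0 := by
  ext F x
  change g.hom (f.hom ((F : C(G, A₁)) x)) = 0
  exact congr(($hfg).hom ((F : C(G, A₁)) x))

/-- `M_G^S` preserves injectivity. [cite: SerreGaloisCohomology1997, I §2.5] -/
theorem coindMap_injective (f : σ₁.toTopRep ⟶ σ₂.toTopRep) (hf : Function.Injective f.hom) :
    Function.Injective (coindMap (G := G) f).hom := fun F F' h =>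
  Subtype.ext (ContinuousMap.ext fun x => hf (by
    have := congr((($h : coindModule σ₂) : C(G, A₂)) x)
    exact this))

/-- `M_G^S` preserves exactness in the middle: an `a* ∈ M_G^S(A₂)` killed by `g` takes values in
the image of the injective `f`, and the pointwise preimage is again continuous (discrete
modules) and `S`-equivariant. [cite: SerreGaloisCohomology1997, I §2.5] -/
theorem coindMap_exact_mid (f : σ₁.toTopRep ⟶ σ₂.toTopRep) (g : σ₂.toTopRep ⟶ σ₃.toTopRep)
    (hf : Function.Injective f.hom) (hmid : ∀ y : A₂, g.hom y = 0 → ∃ x, f.hom x = y)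
    (F : coindModule σ₂) (hF : (coindMap (G := G) g).hom F = 0) :
    ∃ F₁ : coindModule σ₁, (coindMap f).hom F₁ = F := by
  classical
  -- a set-theoretic partial inverse of `f`
  have hval : ∀ x : G, ∃ a : A₁, f.hom a = (F : C(G, A₂)) x := fun x =>
    hmid _ (by
      have := congr((($hF : coindModule σ₃) : C(G, A₃)) x)
      exact this)
  choose a ha using hval
  -- `a` factors through the continuous `F` into a discrete space, hence is continuous
  have hcont : Continuous a := by
    have : a = (fun y : A₂ => if h : ∃ x, (F : C(G, A₂)) x = y then a h.choose else 0) ∘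
        (F : C(G, A₂)) := by
      funext x
      have hx : ∃ x', (F : C(G, A₂)) x' = (F : C(G, A₂)) x := ⟨x, rfl⟩
      simp only [Function.comp_apply, dif_pos hx]
      exact hf (by rw [ha, ha, hx.choose_spec])
    rw [this]
    exact continuous_of_discreteTopology.comp (F : C(G, A₂)).continuous
  refine ⟨⟨⟨a, hcont⟩, fun s x => hf ?_⟩, Subtype.ext (ContinuousMap.ext fun x => ?_)⟩
  · change f.hom (a ((s : G) * x)) = f.hom (σ₁ s (a x))
    rw [ha, hom_comm_rep f s, ha]
    exact (mem_coind_iff σ₂ _).1 F.2 s x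
  · rw [coindMap_hom_coe_apply]
    exact ha x

variable [T2Space G] [TotallyDisconnectedSpace G]

/-- `M_G^S` **preserves surjectivity** for a closed subgroup `S` of a profinite group: with the
continuous `S`-equivariant retraction `r : G → S` (`exists_continuousMap_mul_eq`, Serre I §1.2
Prop. 1) and any set-theoretic section `h` of `g : A₂ → A₃`, the element
`x ↦ r(x) · h(a*(r(x)⁻¹ x))` of `M_G^S(A₂)` lifts `a* ∈ M_G^S(A₃)` (Serre I §2.5: exactness of
`M_G^H` "résulte de l'existence de sections continues"). [cite: SerreGaloisCohomology1997, I §2.5 with I §1.2 Prop. 1] -/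
theorem coindMap_surjective (hS : IsClosed (S : Set G)) (g : σ₂.toTopRep ⟶ σ₃.toTopRep)
    (hg : Function.Surjective g.hom) : Function.Surjective (coindMap (G := G) g).hom := by
  classical
  intro F
  obtain ⟨r, hr, -⟩ := exists_continuousMap_mul_eq S hS
  choose h hh using hg
  -- the `S`-invariant coordinate `y x = r(x)⁻¹ x`
  let y : G → G := fun x => ((r x : S) : G)⁻¹ * x
  have hy : Continuous y := ((continuous_subtype_val.comp r.continuous).inv).mul continuous_id
  have hyS : ∀ (s : S) (x : G), y ((s : G) * x) = y x := fun s x => by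
    simp only [y, hr s s.2 x, mul_inv_rev, mul_assoc, inv_mul_cancel_left]
  let F₂fun : G → A₂ := fun x => σ₂ (r x) (h ((F : C(G, A₃)) (y x)))
  have hF₂ : Continuous F₂fun :=
    σ₂.continuous_apply₂.comp (r.continuous.prodMk
      (continuous_of_discreteTopology.comp ((F : C(G, A₃)).continuous.comp hy)))
  refine ⟨⟨⟨F₂fun, hF₂⟩, fun s x => ?_⟩, Subtype.ext (ContinuousMap.ext fun x => ?_)⟩
  · change σ₂ (r ((s : G) * x)) (h ((F : C(G, A₃)) (y ((s : G) * x)))) =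
      σ₂ s (σ₂ (r x) (h ((F : C(G, A₃)) (y x))))
    have hrs : r ((s : G) * x) = s * r x := Subtype.ext (hr s s.2 x)
    rw [hyS, hrs, map_mul, Module.End.mul_apply]
  · change g.hom (σ₂ (r x) (h ((F : C(G, A₃)) (y x)))) = (F : C(G, A₃)) x
    rw [hom_comm_rep g, hh, ← (mem_coind_iff σ₃ _).1 F.2 (r x) (y x)]
    congr 1
    simp only [y, mul_inv_cancel_left]

/-- **`M_G^S` is exact**: a short exact sequence of discrete `S`-modules induces a short exact
sequence of the discrete `G`-modules `M_G^S(-)` (closed `S` in a profinite `G`; Serre I §2.5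
"`B ↦ M_G^H(B)` est un foncteur exact"). [cite: SerreGaloisCohomology1997, I §2.5] -/
theorem isSES_coindMap (hS : IsClosed (S : Set G)) {f : σ₁.toTopRep ⟶ σ₂.toTopRep}
    {g : σ₂.toTopRep ⟶ σ₃.toTopRep} (h : IsSES f g) :
    IsSES (coindMap (G := G) f) (coindMap (G := G) g) :=
  ⟨coindMap_comp_eq_zero f g h.comp_eq_zero, coindMap_injective f h.injective,
    coindMap_exact_mid f g h.injective h.exact_mid, coindMap_surjective hS g h.surjective⟩

end Functor

/-! ### `M_G^S(C(S, A)) ≅ C(G, A)`: the induced module of a coinduced module is coinduced -/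

section CoindCoind

variable {G : Type u} [Group G] [TopologicalSpace G] [IsTopologicalGroup G] [CompactSpace G]
variable {S : Subgroup G} [hS : IsClosed (S : Set G)]

omit [IsTopologicalGroup G] in
/-- A closed subgroup of a compact group is compact (used as a local instance). [folklore] -/
theorem compactSpace_of_isClosed_subgroup : CompactSpace S :=
  isCompact_iff_compactSpace.mp hS.isCompact

attribute [local instance] compactSpace_of_isClosed_subgroup

variable {A : Type u} [AddCommGroup A] [TopologicalSpace A] [DiscreteTopology A]
variable (σ : ContinuousRep S ℤ A)

/-- The map `M_G^S(C(S, A)) → C(G, A)`, `a* ↦ (x ↦ a*(x⁻¹)(1))` (evaluate at `1 ∈ S` after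
inverting the variable). [cite: SerreGaloisCohomology1997, I §2.5] -/
def coindCoindFun (F : coindModule σ.coind) : C(G, A) :=
  ⟨fun x => ((F : C(G, C(S, A))) x⁻¹) 1,
    (continuous_eval_const (1 : S)).comp ((F : C(G, C(S, A))).continuous.comp continuous_inv)⟩

/-- Unfolding `coindCoindFun`. [folklore] -/
@[simp] theorem coindCoindFun_apply (F : coindModule σ.coind) (x : G) :
    coindCoindFun σ F x = ((F : C(G, C(S, A))) x⁻¹) 1 := rfl

/-- The inverse map `C(G, A) → M_G^S(C(S, A))`, `f ↦ (x ↦ (y ↦ y · f(x⁻¹ y)))`, on functions of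
two variables: it is continuous on `G × S` by the joint continuity of the action. [folklore] -/
def coindCoindInvFun₂ (f : C(G, A)) : C(G × S, A) :=
  ⟨fun p => σ p.2 (f (p.1⁻¹ * (p.2 : G))),
    σ.continuous_apply₂.comp (continuous_snd.prodMk
      (f.continuous.comp ((continuous_fst.inv).mul (continuous_subtype_val.comp continuous_snd))))⟩

/-- The inverse map lands in `M_G^S(C(S, A))`: `F(s x)(y) = s · F(x)(s⁻¹ y)`. [folklore] -/
theorem curry_coindCoindInvFun₂_mem (f : C(G, A)) :
    (coindCoindInvFun₂ σ f).curry ∈ coindModule σ.coind := by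
  refine (mem_coind_iff σ.coind _).2 fun s x => ContinuousMap.ext fun y => ?_
  rw [ContinuousRep.coind_apply_apply]
  change σ y (f (((s : G) * x)⁻¹ * (y : G))) = σ s (σ (s⁻¹ * y) (f (x⁻¹ * ((s⁻¹ * y : S) : G))))
  rw [← Module.End.mul_apply, ← map_mul, mul_inv_cancel_left, Subgroup.coe_mul, Subgroup.coe_inv,
    mul_inv_rev, mul_assoc]

/-- The inverse map `C(G, A) → M_G^S(C(S, A))`. [folklore] -/
def coindCoindInvFun (f : C(G, A)) : coindModule σ.coind :=
  ⟨(coindCoindInvFun₂ σ f).curry, curry_coindCoindInvFun₂_mem σ f⟩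

/-- Unfolding `coindCoindInvFun`: `F(x)(y) = y · f(x⁻¹ y)`. [folklore] -/
@[simp] theorem coindCoindInvFun_coe_apply_apply (f : C(G, A)) (x : G) (y : S) :
    ((coindCoindInvFun σ f : coindModule σ.coind) : C(G, C(S, A))) x y =
      σ y (f (x⁻¹ * (y : G))) := rfl

/-- An element `a*` of `M_G^S(C(S, A))` is determined by the values `a*(x)(1)`:
`a*(x)(y) = y · a*(y⁻¹ x)(1)`. [folklore] -/
theorem coe_apply_apply_eq (F : coindModule σ.coind) (x : G) (y : S) :
    (F : C(G, C(S, A))) x y = σ y (((F : C(G, C(S, A))) ((y : G)⁻¹ * x)) 1) := by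
  have h := (mem_coind_iff σ.coind _).1 F.2 y ((y : G)⁻¹ * x)
  rw [mul_inv_cancel_left] at h
  rw [h, ContinuousRep.coind_apply_apply, inv_mul_cancel]

/-- **`M_G^S(C(S, A)) ≅ C(G, A)`** as topological `ℤ`-modules (both discrete): the continuous
linear equivalence underlying `coindCoindIso`. [cite: SerreGaloisCohomology1997, I §2.5] -/
def coindCoindEquiv : coindModule σ.coind ≃L[ℤ] C(G, A) :=
  haveI := discreteTopology_coind (S := S) σ.coind
  haveI : DiscreteTopology C(G, A) := discreteTopology_continuousMap G A
  { toFun := coindCoindFun σ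
    invFun := coindCoindInvFun σ
    map_add' := fun _ _ => rfl
    map_smul' := fun _ _ => rfl
    left_inv := fun F => Subtype.ext (ContinuousMap.ext fun x => ContinuousMap.ext fun y => by
      rw [coindCoindInvFun_coe_apply_apply, coindCoindFun_apply, coe_apply_apply_eq σ F x y,
        mul_inv_rev, inv_inv])
    right_inv := fun f => ContinuousMap.ext fun x => by
      rw [coindCoindFun_apply, coindCoindInvFun_coe_apply_apply, inv_inv, Subgroup.coe_one,
        mul_one, map_one, Module.End.one_apply]
    continuous_toFun := continuous_of_discreteTopology
    continuous_invFun := continuous_of_discreteTopology }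

/-- **The induced module of the coinduced module is the coinduced module of the trivial
module**: `M_G^S(C(S, A)) ≅ C(G, A)` as topological representations of `G`, where `C(S, A)` is the
discrete `S`-module `σ.coind` (`(s f)(y) = s f(s⁻¹ y)`) and `C(G, A)` the discrete `G`-module
`(ContinuousRep.trivial G ℤ A).coind` (`(g f)(x) = f(g⁻¹ x)`). This is Serre's transitivity
`M_G^S ∘ M_S^1 = M_G^1` up to the untwisting isomorphisms `C(S, A) ≅ M_S^1(A)`,
`f ↦ (y ↦ y f(y⁻¹))`, and `M_G^1(A) ≅ C(G, A)`, `f ↦ f ∘ (·)⁻¹`.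
[cite: SerreGaloisCohomology1997, I §2.5] [cite: Shatz1972, Ch. II §2 Prop. 5] -/
def coindCoindIso :
    (coindRep σ.coind).toTopRep ≅ (ContinuousRep.trivial G ℤ A).coind.toTopRep :=
  topRepIsoOfEquiv (coindCoindEquiv σ) fun g F => ContinuousMap.ext fun x => by
    change ((F : C(G, C(S, A))) (x⁻¹ * g)) 1 = ((F : C(G, C(S, A))) (g⁻¹ * x)⁻¹) 1
    rw [mul_inv_rev, inv_inv]

variable [T2Space G]

/-- **`M_G^S(C(S, A))` is `G`-acyclic**: `H^{n+1}(G, M_G^S(C(S, A))) = 0`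
(`coindCoindIso` and the acyclicity of coinduced modules, `subsingleton_coind`).
[cite: Shatz1972, Ch. II §2 Thm. 8] -/
theorem subsingleton_coindRep_coind (n : ℕ) :
    Subsingleton (continuousCohomology (n + 1) (coindRep σ.coind).toTopRep) :=
  haveI := subsingleton_coind (ContinuousRep.trivial G ℤ A) n
  subsingleton_continuousCohomology_of_iso (coindCoindIso σ).symm (n + 1)

end CoindCoind

/-! ### Invariants of `M_G^S(B)` and the transfer of vanishing -/

section Transfer

variable {G : Type u} [Group G] [TopologicalSpace G] [IsTopologicalGroup G] [CompactSpace G]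
  [T2Space G] [TotallyDisconnectedSpace G]
variable {S : Subgroup G} [hS : IsClosed (S : Set G)]

attribute [local instance] compactSpace_of_isClosed_subgroup

omit [T2Space G] [TotallyDisconnectedSpace G] hS in
/-- **`M_G^S(B)^G = B^S`**: an element of `M_G^S(B)` is `G`-invariant iff it is a constant function,
whose value is then `S`-invariant (`a*(x g) = a*(x)` for all `g` forces `a* ≡ a*(1)`, and
`a*(1) = a*(s) = s a*(1)`). [cite: SerreGaloisCohomology1997, I §2.5] -/
theorem coindRep_mem_invariants_iff {B : Type u} [AddCommGroup B] [TopologicalSpace B]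
    [DiscreteTopology B] (τ : ContinuousRep S ℤ B) (F : coindModule τ) :
    F ∈ (coindRep τ).toTopRep.ρ.invariants ↔
      ∃ b : B, (∀ s : S, τ s b = b) ∧ (F : C(G, B)) = ContinuousMap.const G b := by
  constructor
  · intro hF
    have hconst : ∀ x, (F : C(G, B)) x = (F : C(G, B)) 1 := fun x => by
      have := congr(((($((mem_invariants _).1 hF x)) : coindModule τ) : C(G, B)) 1)
      change ((coindRep τ x F : coindModule τ) : C(G, B)) 1 = (F : C(G, B)) 1 at this
      rw [coindRep_apply_apply, one_mul] at this
      exact this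
    refine ⟨(F : C(G, B)) 1, fun s => ?_, ContinuousMap.ext fun x => hconst x⟩
    rw [← (mem_coind_iff τ _).1 F.2 s 1, mul_one, hconst]
  · rintro ⟨b, hb, hFb⟩
    refine (mem_invariants _).2 fun g => Subtype.ext (ContinuousMap.ext fun x => ?_)
    change ((coindRep τ g F : coindModule τ) : C(G, B)) x = (F : C(G, B)) x
    rw [coindRep_apply_apply, hFb, ContinuousMap.const_apply, ContinuousMap.const_apply]

omit [IsTopologicalGroup G] [CompactSpace G] [T2Space G] [TotallyDisconnectedSpace G] hS in
/-- The constant function with `S`-invariant value `b` is a `G`-invariant element of `M_G^S(B)`.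
[folklore] -/
def constCoind {B : Type u} [AddCommGroup B] [TopologicalSpace B] [DiscreteTopology B]
    (τ : ContinuousRep S ℤ B) (b : B) (hb : ∀ s : S, τ s b = b) : coindModule τ :=
  ⟨ContinuousMap.const G b, fun s x => by
    rw [ContinuousMap.const_apply, ContinuousMap.const_apply]
    exact (hb s).symm⟩

variable {A : Type u} [AddCommGroup A] [TopologicalSpace A] [DiscreteTopology A]

/-- **Shapiro's lemma in vanishing form** (Serre I §2.5 Prop. 10 / Shatz II §2 Thm. 8, the half
"`H^q(S, A) = 0 ⇒ H^q(G, M_G^S(A)) = 0`"), for a closed subgroup `S` of a profinite group `G`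
and a discrete `S`-module `A`, in every degree `q = n + 1 ≥ 1`. Proof by dimension shifting along
`0 → A → C(S, A) → Q → 0` and its (exact) image under `M_G^S`: in degree `1`,
`M_G^S(C(S,A))^G = C(S,A)^S → M_G^S(Q)^G = Q^S` is onto because `H¹(S, A) = 0`
(`IsSES.exists_invariant_lift`, `IsSES.subsingleton_one`); in degree `n + 2`, `H^{n+1}(S, Q) = 0`
(`IsSES.subsingleton_X₃`), so `H^{n+1}(G, M_G^S(Q)) = 0` by induction, and
`H^{n+2}(G, M_G^S(A)) = 0` by `IsSES.subsingleton_X₁`, `M_G^S(C(S, A))` being `G`-acyclic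
(`subsingleton_coindRep_coind`). [cite: SerreGaloisCohomology1997, I §2.5 Prop. 10]
[cite: Shatz1972, Ch. II §2 Thm. 8 (Faddeev–Shapiro)] -/
theorem subsingleton_coindRep_of_subsingleton :
    ∀ (n : ℕ) {A : Type u} [AddCommGroup A] [TopologicalSpace A] [DiscreteTopology A]
      (σ : ContinuousRep S ℤ A),
      Subsingleton (continuousCohomology (n + 1) σ.toTopRep) →
        Subsingleton (continuousCohomology (n + 1) (coindRep (G := G) σ).toTopRep)
  | 0, A, _, _, _, σ, h1 => by
    refine (isSES_coindMap hS (isSES_coind σ)).subsingleton_one (subsingleton_coindRep_coind σ 0)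
      fun v hv => ?_
    -- `v ∈ M_G^S(Q)^G` is constant with value `q ∈ Q^S`
    obtain ⟨q, hq, hvq⟩ := (coindRep_mem_invariants_iff σ.coindQuot v).1 hv
    -- lift `q` to `C(S, A)^S` using `H¹(S, A) = 0`
    obtain ⟨i, hi, hiq⟩ := (isSES_coind σ).exists_invariant_lift (subsingleton_coind σ 0) h1 q
      ((mem_invariants _).2 hq)
    refine ⟨constCoind σ.coind i ((mem_invariants _).1 hi), (coindRep_mem_invariants_iff σ.coind
      _).2 ⟨i, (mem_invariants _).1 hi, rfl⟩, Subtype.ext (ContinuousMap.ext fun x => ?_)⟩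
    rw [coindMap_hom_coe_apply, hvq, ContinuousMap.const_apply]
    exact hiq
  | n + 1, A, _, _, _, σ, h => by
    have hQ : Subsingleton (continuousCohomology (n + 1) σ.coindQuot.toTopRep) :=
      (isSES_coind σ).subsingleton_X₃ n (subsingleton_coind σ n) h
    have hMQ := subsingleton_coindRep_of_subsingleton n σ.coindQuot hQ
    exact (isSES_coindMap hS (isSES_coind σ)).subsingleton_X₁ n hMQ
      (subsingleton_coindRep_coind σ (n + 1))

end Transfer

end Literature.NumberTheory.GaloisRepresentations

end
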